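import Mathlib
import Summits.SmoothPoincare4.SmoothPoincare4.Theses.DottedCircleRasmussen
import Literature.Topology.FourManifolds.MMSWRasmussen
import Literature.Topology.FourManifolds.MMSWRasmussenFacts
import Literature.Topology.FourManifolds.SliceDiscInTransport
import Summits.SmoothPoincare4.SmoothPoincare4.Theorems.DottedCircleRasmussenDcrGfgmw
import Summits.SmoothPoincare4.SmoothPoincare4.Theses.SchoenfliesSplit

/-!
# Sketch for crux-ideate `stmt-SmoothPoincare4-17014` (DcrRigidity = ¬ DcrGap), ideator 2, round 1

First lemmas of the two idea cards, stated over existing declarations (sorries allowed here;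
this file only has to elaborate).

* Card `invertible-sphere-transplant`: `transplant_of_punctureEmbeds`,
  `EveryHomotopySphereInvertible`, `dcrRigidity_of_pointwise` (proved: pure logic),
  `dcrRigidity_of_invertible`.
* Card `dual-sphere-norman-sector`: `HasUnitWinding`, `exists_sliceDisc_sphere_of_hasUnitWinding`,
  `dcrRigidity_unitWinding_sector` (proved from the previous one: pure logic).
-/

open scoped Manifold ContDiff Topology ContinuousMap

set_option linter.dupNamespace false
open Set Function
open Literature.Topology.FourManifolds
open Literature.AlgebraicTopology.Homotopy.HopfFibration (zC)
open Summit.SmoothPoincare4.SmoothPoincare4.Theses.DottedCircleRasmussen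

noncomputable section

namespace Summit.SmoothPoincare4.SmoothPoincare4.Cruxes.DcrRigidity.Sketch

local notation "𝔼⁴" => EuclideanSpace ℝ (Fin 4)
local notation "𝔼²" => EuclideanSpace ℝ (Fin 2)
local notation "𝕊¹" => (Metric.sphere (0 : EuclideanSpace ℝ (Fin 2)) 1)
local notation "𝕊⁴" => (Metric.sphere (0 : EuclideanSpace ℝ (Fin 5)) 1)

/-! ## Card A — invertible-sphere transplant -/

/-- Corestriction of a `D_k`-complement slice datum to an open submanifold containing the chart
and the disc (copy of the tree's `Knot.IsSliceDiscIn.codRestrict`). Provable now — proved here. -/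
theorem isSliceDiscInComplement_codRestrict {k : ℕ} {K : 𝕊¹ → 𝔼⁴}
    {M : Type} [TopologicalSpace M] [ChartedSpace 𝔼⁴ M] [IsManifold (𝓡 4) ∞ M]
    {e : 𝔼⁴ → M} {f : 𝔼² → M} (h : MMSW.IsSliceDiscInComplement k K M e f)
    (U : TopologicalSpace.Opens M) (heU : ∀ v, e v ∈ U) (hfU : ∀ y, f y ∈ U) :
    MMSW.IsSliceDiscInComplement k K U (fun v => (⟨e v, heU v⟩ : U))
      (fun y => (⟨f y, hfU y⟩ : U)) := by
  obtain ⟨he, hf, hinj, hmf, hproper, hbdry⟩ := h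
  refine ⟨he.codRestrict_opens U heU, (ContMDiff.subtypeVal_comp_iff U _).1 hf,
    fun x hx y hy hxy => hinj hx hy (congrArg Subtype.val hxy), fun x hx => ?_, fun x hx => ?_,
    fun x => Subtype.ext (hbdry x)⟩
  · rw [mfderiv_codRestrict_opens_eq (f := f) (g := fun y => (⟨f y, hfU y⟩ : U)) (fun y => rfl)
      ((hf x).mdifferentiableAt (by simp))]
    exact hmf x hx
  · rintro ⟨v, hv, hfv⟩
    exact hproper x hx ⟨v, hv, congrArg Subtype.val hfv⟩

/-- **First lemma of card A (transplant through an `S⁴`-embeddable puncture).** If the model knot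
`K ⊂ ∂D_k` bounds a slice disc in the complement of `e(D_k)` inside ANY smooth 4-manifold `M`,
and some puncture `M ∖ {q}` off the chart and the disc embeds smoothly in `S⁴`, then `K` bounds
such a disc in `S⁴` (for the composed chart). The `D_k`-analogue of the tree's
`ZseSVanishesOnPairs.Negative.isSmoothlySlice_of_isSliceDiscIn_of_punctureEmbeds` (k = 0):
corestrict to the open submanifold, compose with the embedding
(`Theorems.DcrGfgmw.isSliceDiscInComplement_comp`). Provable now — proved here. -/
theorem transplant_of_punctureEmbeds {k : ℕ} {K : 𝕊¹ → 𝔼⁴}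
    {M : Type} [TopologicalSpace M] [T2Space M] [ChartedSpace 𝔼⁴ M] [IsManifold (𝓡 4) ∞ M]
    {e : 𝔼⁴ → M} {f : 𝔼² → M} (h : MMSW.IsSliceDiscInComplement k K M e f)
    {q : M} (hqe : q ∉ range e) (hqf : q ∉ range f)
    {ι : ↥((⟨{q}ᶜ, isOpen_compl_singleton⟩ : TopologicalSpace.Opens M)) → 𝕊⁴}
    (hι : Manifold.IsSmoothEmbedding (𝓡 4) (𝓡 4) ∞ ι) :
    ∃ (e' : 𝔼⁴ → 𝕊⁴) (f' : 𝔼² → 𝕊⁴), MMSW.IsSliceDiscInComplement k K 𝕊⁴ e' f' := by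
  have heU : ∀ v, e v ∈ (⟨{q}ᶜ, isOpen_compl_singleton⟩ : TopologicalSpace.Opens M) := by
    intro v (hv : e v ∈ ({q} : Set M))
    exact hqe ⟨v, hv⟩
  have hfU : ∀ y, f y ∈ (⟨{q}ᶜ, isOpen_compl_singleton⟩ : TopologicalSpace.Opens M) := by
    intro y (hy : f y ∈ ({q} : Set M))
    exact hqf ⟨y, hy⟩
  exact ⟨_, _, Theorems.DcrGfgmw.isSliceDiscInComplement_comp
    (isSliceDiscInComplement_codRestrict h _ heU hfU) hι⟩

/-- **INV — every homotopy 4-sphere is invertible**, in the puncture form: every puncture of every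
smooth homotopy 4-sphere embeds smoothly in `S⁴` (⟺ in `ℝ⁴`; ⟺ `M ∖ ball ↪ S⁴` ⟺ `∃ M', M # M' ≅ S⁴`;
Freedman–Gompf–Morrison–Walker 2010, §1 footnote 1: the Schoenflies problem "asks if there are
invertible homotopy spheres", so SPC4 ⟺ INV ∧ Schoenflies⁴). OPEN; implied by SPC4. In the tree this
is, verbatim up to `ℝ⁴ ↪ S⁴` and the packaging `HomotopySphere 4`, the staffed crux
`SchoenfliesSplit.SchsplitPuncturedEmbeds` (item stmt-SmoothPoincare4-0371, rank 2 of route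
SchoenfliesSplit); this `Type`-binder form is the one the transplant consumes. -/
def EveryHomotopySphereInvertible : Prop :=
  ∀ (M : Type) [TopologicalSpace M] [T2Space M] [SecondCountableTopology M]
    [ChartedSpace 𝔼⁴ M] [IsManifold (𝓡 4) ∞ M],
    Nonempty (M ≃ₕ 𝕊⁴) → ∀ q : M,
      ∃ ι : ↥((⟨{q}ᶜ, isOpen_compl_singleton⟩ : TopologicalSpace.Opens M)) → 𝕊⁴,
        Manifold.IsSmoothEmbedding (𝓡 4) (𝓡 4) ∞ ι

/-- **The existing crux (A) of route SchoenfliesSplit gives INV in the form used here** (packaging: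
`CompactSpace` and a `SmoothOrientation` from `M ≃ₕ S⁴` by the landed facts
`compactSpace_of_homotopyEquiv_sphere_four_holds`, `isOrientable_of_homotopyEquiv_sphere_four_holds`;
then compose `M ∖ {q} ↪ ℝ⁴` with the standard `ℝ⁴ ↪ S⁴`). Provable now. -/
theorem everyHomotopySphereInvertible_of_schsplit
    (hA : Summit.SmoothPoincare4.SmoothPoincare4.Theses.SchoenfliesSplit.SchsplitPuncturedEmbeds) :
    EveryHomotopySphereInvertible := by
  sorry

/-- **Pointwise transplant ⇒ the crux** (pure logic over the route decls; the literal `S⁴` is an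
admissible `N` by `Diffeomorph.refl`). -/
theorem dcrRigidity_of_pointwise
    (h : ∀ (k : ℕ) (K : 𝕊¹ → 𝔼⁴) (M : Type) [TopologicalSpace M] [T2Space M]
      [SecondCountableTopology M] [ChartedSpace 𝔼⁴ M] [IsManifold (𝓡 4) ∞ M],
      Nonempty (M ≃ₕ 𝕊⁴) → ∀ (e : 𝔼⁴ → M) (f : 𝔼² → M),
        MMSW.IsSliceDiscInComplement k K M e f →
        ∃ (e' : 𝔼⁴ → 𝕊⁴) (f' : 𝔼² → 𝕊⁴), MMSW.IsSliceDiscInComplement k K 𝕊⁴ e' f') :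
    DcrRigidity := by
  rintro ⟨k, K, -, ⟨M, i1, i2, i3, i4, i5, hM, e, f, hf⟩, hno⟩
  obtain ⟨e', f', h'⟩ := @h k K M i1 i2 i3 i4 i5 hM e f hf
  exact hno _ ⟨Diffeomorph.refl _ _ _⟩ e' f' h'

/-- **Card A, apex composition: INV ⇒ DcrRigidity.** From `transplant_of_punctureEmbeds` plus the
`D_k`-analogue of `IsSliceDiscIn.exists_notMem_range` (re-choose chart and disc off a point:
shrink the chart outside a ball containing `D_k`, dimension count for `f(ℝ²)`). -/
theorem dcrRigidity_of_invertible (hInv : EveryHomotopySphereInvertible) : DcrRigidity := by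
  sorry

/-- **Cross-route edge: crux (A) of SchoenfliesSplit ⇒ the kill switch of DottedCircleRasmussen.**
Contrapositive: a one-handle slice gap (`DcrGap`) refutes `SchsplitPuncturedEmbeds` — its witnessing
sphere is NON-INVERTIBLE (no puncture embeds in `S⁴`; not `B ∪ B⁴` for any Schoenflies ball `B`). -/
theorem dcrRigidity_of_schsplitPuncturedEmbeds
    (hA : Summit.SmoothPoincare4.SmoothPoincare4.Theses.SchoenfliesSplit.SchsplitPuncturedEmbeds) :
    DcrRigidity :=
  dcrRigidity_of_invertible (everyHomotopySphereInvertible_of_schsplit hA)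

theorem not_schsplitPuncturedEmbeds_of_dcrGap (hX : DcrGap) :
    ¬ Summit.SmoothPoincare4.SmoothPoincare4.Theses.SchoenfliesSplit.SchsplitPuncturedEmbeds :=
  fun hA => dcrRigidity_of_schsplitPuncturedEmbeds hA hX

/-! ## Card B — the dual-sphere (Norman) sector -/

/-- **Winding number `+1` about the `j`-th dotted circle**: the plane curve `z ∘ K` is freely
homotopic in `ℂ ∖ {c_j}` to the standard positive circle of radius `2` about `c_j`
(cf. `MMSW.IsNullHomologous`: homotopic to a constant for EVERY `j`). Equivalently `K` meets the
belt sphere `{pt} × S²` of the `j`-th handle algebraically once. -/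
def HasUnitWinding (k : ℕ) (K : 𝕊¹ → 𝔼⁴) (j : Fin k) : Prop :=
  ∃ H : unitInterval × 𝕊¹ → ℂ, Continuous H ∧ (∀ p, H p ≠ MMSW.holeCentre k j) ∧
    (∀ t, H (0, t) = zC (K t)) ∧
    ∀ t, H (1, t) = MMSW.holeCentre k j + 2 * (⟨(t : 𝔼²) 0, (t : 𝔼²) 1⟩ : ℂ)

/-- **First lemma of card B (Norman sector is slice outright).** A model knot with winding number
`±1` about some dotted circle bounds a smooth proper disc in `S⁴ ∖ e₀(D_k) ≅ ♮ᵏ(B² × S²)` for the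
standard chart `e₀` — whatever else it does: immersed disc meeting the belt sphere `S_j` once
(`π₁(♮ᵏ(B²×S²) ∖ S_j) = ℤ`), then Norman's trick along parallels of `S_j` (Norman 1969;
Freedman–Quinn §1.9 Exercise); `k = 1`: Davis–Nagel–Park–Ray 2018 Thm 1.1. The mirror
`MMSW.modelMirror` handles winding `-1`. -/
theorem exists_sliceDisc_sphere_of_hasUnitWinding {k : ℕ} {K : 𝕊¹ → 𝔼⁴}
    (hK : MMSW.IsModelKnot k K) (j : Fin k)
    (hw : HasUnitWinding k K j ∨ HasUnitWinding k (MMSW.modelMirror ∘ K) j) :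
    ∃ (e' : 𝔼⁴ → 𝕊⁴) (f' : 𝔼² → 𝕊⁴), MMSW.IsSliceDiscInComplement k K 𝕊⁴ e' f' := by
  sorry

/-- **Card B, sector theorem: DcrRigidity holds on the unit-winding sector with no hypothesis on
the homotopy sphere** (the `M`-datum is not even used). -/
theorem dcrRigidity_unitWinding_sector
    (hB : ∀ (k : ℕ) (K : 𝕊¹ → 𝔼⁴), MMSW.IsModelKnot k K → ∀ j : Fin k,
      (HasUnitWinding k K j ∨ HasUnitWinding k (MMSW.modelMirror ∘ K) j) →
      ∃ (e' : 𝔼⁴ → 𝕊⁴) (f' : 𝔼² → 𝕊⁴), MMSW.IsSliceDiscInComplement k K 𝕊⁴ e' f')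
    (k : ℕ) (K : 𝕊¹ → 𝔼⁴) (hK : MMSW.IsModelKnot k K) (j : Fin k)
    (hw : HasUnitWinding k K j ∨ HasUnitWinding k (MMSW.modelMirror ∘ K) j) :
    ∀ (N : Type) [TopologicalSpace N] [T2Space N] [SecondCountableTopology N]
      [ChartedSpace 𝔼⁴ N] [IsManifold (𝓡 4) ∞ N],
      Nonempty (N ≃ₘ⟮𝓡 4, 𝓡 4⟯ 𝕊⁴) →
      ∃ (e' : 𝔼⁴ → N) (f' : 𝔼² → N), MMSW.IsSliceDiscInComplement k K N e' f' := by
  intro N _ _ _ _ _ hN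
  obtain ⟨Φ⟩ := hN
  obtain ⟨e', f', h'⟩ := hB k K hK j hw
  exact ⟨_, _, Theorems.DcrGfgmw.isSliceDiscInComplement_comp_diffeomorph h' Φ.symm⟩

end Summit.SmoothPoincare4.SmoothPoincare4.Cruxes.DcrRigidity.Sketch

end
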